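import Summits.Ventures.CertifiedManyBodySolver.Observables.SourcedGibbsTrialCapKSpace
import Summits.Ventures.CertifiedManyBodySolver.Observables.PinningFieldFloorU2
import HarnessLib

/-!
# The HF–BCS sourced cap in momentum space (IV): Rows cells and the B′1 literal leaf at `(U, μ, h) = (2, 1/2, √2/7)`

HONEST FRAMING: zero compute in this file; implications only. The hypothesis `hnum` below is a NUMERICAL inequality
about an explicit finite sum of elementary functions of the lattice momenta (the right-hand side of
`groundEnergy_dWaveSourceTorus_le_HFBCS_kSpace'`) — exactly what the `hubbard-obs` cell certifies by two-engine
interval arithmetic (kit job of record quoted on the cell's STATUS; e.g. `L = 256, β = 100, μ' = −7/20`: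
`φ = −1.8626759` at `μ = 1/2`); it is NOT proved here. A sourced variational CAP bounds nothing about order by
itself; together with a certified source-free FLOOR row at the same `(μ, L)` it yields a finite-`h` response floor —
an instrument statement (CQ-TABLE §B′1, `U = 2`, off the cuprate anchor), not order of the source-free model, not a
superconductivity verdict; no phase sentence.

* `sourcedTorusEnergyUpperRow_of_HFBCS_kSpace` — generic `(U, μ, h)`, trial `(μ', β)`: the certified k-space
  inequality `RHS ≤ e·L²` gives the Rows cell `SourcedTorusEnergyUpperRow L 0 U μ h e`;
* `sourcedTorusEnergyUpperRow_U2_of_kSpace_numerics` — the literal B′1 point `dWaveSourceTorus L 2 (1/2) (√2/7)`;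
* `dWaveSourceDensity_U2_ge_of_lowerRow_of_kSpace_numerics` — with hubbard-cq-p1's consumer
  `dWaveSourceDensity_U2_ge_of_rows`: a source-free floor cell `lo` at `h = 0` and the certified k-space cap `φ` give
  `(lo − φ)/(2√2/7) ≤ m_L(√2/7)` on the same torus.

References: Bach–Lieb–Solovej, J. Stat. Phys. 76 (1994) 3, §2 [BachLiebSolovej1994]; Koma–Tasaki,
J. Stat. Phys. 76 (1994) 745, §1 [KomaTasaki1994].
-/

noncomputable section

open Matrix Finset Literature.MathematicalPhysics.QuantumLattice Literature.Probability.LatticeModels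
open Literature.MathematicalPhysics.QuantumLattice.HubbardWave0

namespace Summit.Ventures.CertifiedManyBodySolver.Observables

/-- **Certified k-space HF–BCS inequality ⇒ energy CEILING cell** (generic point, `L ≥ 3`): if the explicit momentum
sum of `groundEnergy_dWaveSourceTorus_le_HFBCS_kSpace'` at trial parameters `(μ', β)` is certified to be `≤ e·L²`,
then `SourcedTorusEnergyUpperRow L 0 U μ h e` (`E₀(dWaveSourceTorusTT' L 0 U μ h) ≤ e·L²`). [cite: BachLiebSolovej1994, §2] -/
theorem sourcedTorusEnergyUpperRow_of_HFBCS_kSpace (L : ℕ) [NeZero L] (hL : 3 ≤ L) (U μ μ' h β : ℝ) {e : ℚ}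
    (hnum : ((-(∑ k : TorusSite 2 L, Real.sqrt ((torusBand L k - μ') ^ 2 + (2 * Real.sqrt 2 * h * dWaveGap k) ^ 2) * Real.tanh (β * Real.sqrt ((torusBand L k - μ') ^ 2 + (2 * Real.sqrt 2 * h * dWaveGap k) ^ 2) / 2)) - μ' * (L : ℝ) ^ 2) +
        (μ' - μ) * (∑ k : TorusSite 2 L, (1 - (torusBand L k - μ') * Real.tanh (β * Real.sqrt ((torusBand L k - μ') ^ 2 + (2 * Real.sqrt 2 * h * dWaveGap k) ^ 2) / 2) / Real.sqrt ((torusBand L k - μ') ^ 2 + (2 * Real.sqrt 2 * h * dWaveGap k) ^ 2))) +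
        U * ((L : ℝ) ^ 2 * ((∑ k : TorusSite 2 L, (1 - (torusBand L k - μ') * Real.tanh (β * Real.sqrt ((torusBand L k - μ') ^ 2 + (2 * Real.sqrt 2 * h * dWaveGap k) ^ 2) / 2) / Real.sqrt ((torusBand L k - μ') ^ 2 + (2 * Real.sqrt 2 * h * dWaveGap k) ^ 2))) / (2 * (L : ℝ) ^ 2)) ^ 2)) ≤ ((e : ℚ) : ℝ) * (L : ℝ) ^ 2) :
    SourcedTorusEnergyUpperRow L 0 U μ h e := by
  have hcap := (groundEnergy_dWaveSourceTorus_le_HFBCS_kSpace' hL U μ μ' h β).trans hnum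
  unfold SourcedTorusEnergyUpperRow
  rw [dWaveSourceTorusTT'_zero_tp]
  -- the `DecidableEq (FermionTorus 2 L)` path of `Rows/` (linear order) vs the library instance: `Subsingleton`
  refine le_trans (le_of_eq ?_) hcap
  congr 1

/-- **B′1 literal CEILING cell from certified k-space numerics**: at `(U, μ, t′, h) = (2, 1/2, 0, √2/7)`, a certified
inequality `RHS_{L,β,μ'} ≤ φ·L²` for the explicit momentum sum gives
`SourcedTorusEnergyUpperRow L 0 2 (1/2) (√2/7) φ`. [cite: BachLiebSolovej1994, §2] -/
theorem sourcedTorusEnergyUpperRow_U2_of_kSpace_numerics (L : ℕ) [NeZero L] (hL : 3 ≤ L) (μ' β : ℝ) {φ : ℚ}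
    (hnum : ((-(∑ k : TorusSite 2 L, Real.sqrt ((torusBand L k - μ') ^ 2 + (2 * Real.sqrt 2 * (Real.sqrt 2 / 7) * dWaveGap k) ^ 2) * Real.tanh (β * Real.sqrt ((torusBand L k - μ') ^ 2 + (2 * Real.sqrt 2 * (Real.sqrt 2 / 7) * dWaveGap k) ^ 2) / 2)) - μ' * (L : ℝ) ^ 2) +
        (μ' - (1 / 2 : ℝ)) * (∑ k : TorusSite 2 L, (1 - (torusBand L k - μ') * Real.tanh (β * Real.sqrt ((torusBand L k - μ') ^ 2 + (2 * Real.sqrt 2 * (Real.sqrt 2 / 7) * dWaveGap k) ^ 2) / 2) / Real.sqrt ((torusBand L k - μ') ^ 2 + (2 * Real.sqrt 2 * (Real.sqrt 2 / 7) * dWaveGap k) ^ 2))) +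
        2 * ((L : ℝ) ^ 2 * ((∑ k : TorusSite 2 L, (1 - (torusBand L k - μ') * Real.tanh (β * Real.sqrt ((torusBand L k - μ') ^ 2 + (2 * Real.sqrt 2 * (Real.sqrt 2 / 7) * dWaveGap k) ^ 2) / 2) / Real.sqrt ((torusBand L k - μ') ^ 2 + (2 * Real.sqrt 2 * (Real.sqrt 2 / 7) * dWaveGap k) ^ 2))) / (2 * (L : ℝ) ^ 2)) ^ 2)) ≤ ((φ : ℚ) : ℝ) * (L : ℝ) ^ 2) :
    SourcedTorusEnergyUpperRow L 0 2 (1 / 2) (Real.sqrt 2 / 7) φ :=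
  sourcedTorusEnergyUpperRow_of_HFBCS_kSpace L hL 2 (1 / 2) μ' (Real.sqrt 2 / 7) β hnum

/-- **B′1 literal response FLOOR from a source-free floor cell and certified k-space cap numerics** (one torus
`L ≥ 3`): `hlo : SourcedTorusEnergyLowerRow L 0 2 (1/2) 0 lo` (pilot certificate, `lo·L² ≤ E₀(A_L(h = 0))`) and the
certified k-space inequality at `h = √2/7` give `(lo − φ)/(2·√2/7) ≤ m_L(√2/7) = dWaveSourceDensity L 2 (1/2) (√2/7)`
(hubbard-cq-p1's `dWaveSourceDensity_U2_ge_of_rows`). Teeth iff `φ < lo`. [cite: KomaTasaki1994, §1] -/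
theorem dWaveSourceDensity_U2_ge_of_lowerRow_of_kSpace_numerics (L : ℕ) [NeZero L] (hL : 3 ≤ L) (μ' β : ℝ)
    {lo φ : ℚ} (hlo : SourcedTorusEnergyLowerRow L 0 2 (1 / 2) 0 lo)
    (hnum : ((-(∑ k : TorusSite 2 L, Real.sqrt ((torusBand L k - μ') ^ 2 + (2 * Real.sqrt 2 * (Real.sqrt 2 / 7) * dWaveGap k) ^ 2) * Real.tanh (β * Real.sqrt ((torusBand L k - μ') ^ 2 + (2 * Real.sqrt 2 * (Real.sqrt 2 / 7) * dWaveGap k) ^ 2) / 2)) - μ' * (L : ℝ) ^ 2) +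
        (μ' - (1 / 2 : ℝ)) * (∑ k : TorusSite 2 L, (1 - (torusBand L k - μ') * Real.tanh (β * Real.sqrt ((torusBand L k - μ') ^ 2 + (2 * Real.sqrt 2 * (Real.sqrt 2 / 7) * dWaveGap k) ^ 2) / 2) / Real.sqrt ((torusBand L k - μ') ^ 2 + (2 * Real.sqrt 2 * (Real.sqrt 2 / 7) * dWaveGap k) ^ 2))) +
        2 * ((L : ℝ) ^ 2 * ((∑ k : TorusSite 2 L, (1 - (torusBand L k - μ') * Real.tanh (β * Real.sqrt ((torusBand L k - μ') ^ 2 + (2 * Real.sqrt 2 * (Real.sqrt 2 / 7) * dWaveGap k) ^ 2) / 2) / Real.sqrt ((torusBand L k - μ') ^ 2 + (2 * Real.sqrt 2 * (Real.sqrt 2 / 7) * dWaveGap k) ^ 2))) / (2 * (L : ℝ) ^ 2)) ^ 2)) ≤ ((φ : ℚ) : ℝ) * (L : ℝ) ^ 2) :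
    (((lo : ℚ) : ℝ) - ((φ : ℚ) : ℝ)) / (2 * (Real.sqrt 2 / 7)) ≤ dWaveSourceDensity L 2 (1 / 2) (Real.sqrt 2 / 7) :=
  dWaveSourceDensity_U2_ge_of_rows L hlo (sourcedTorusEnergyUpperRow_U2_of_kSpace_numerics L hL μ' β hnum)

end Summit.Ventures.CertifiedManyBodySolver.Observables

end
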